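import Summits.ABC.StewartYu.ArchG3RecLinesD
import Summits.ABC.StewartYu.ArchG3RecLinesClosedK
import Summits.ABC.StewartYu.ArchG3RecU0
import Summits.ABC.StewartYu.ArchG3PackClosedV
import HarnessLib

/-!
# The archimedean record `ArchG3Rec` — letter lines in closed form, H family (half step): SCHEDULE ATOMS at the level of a half step

Support file (theorems only; no named facts). Cell `abc-stewartyu`, route `YuMatveevShapeRat`, crux r2 `ArchCoreRat` (stmt-ABC-20502),
line `arch-g3-frame`, seam (B) of `stub_recLinesArch`, plan R50: the half-step family `HalfStepLinesK` is seat p5's. This file: the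
LEVEL-CORRELATED schedule atoms the half step `(lev, n) → (lev+1, 0)` needs (every `T′`-proportional cost must be paid by the order drop
`T lev` at the SAME level, not by the START order `T₀` — uniform-in-level bounds fail inside the `2ⁿ`-threshold at floored levels):
* `T_succ_le`, `R_le_two_T` (`R s ≤ 2·T s + 2·(Ŝ + 1 − s)`), **`Tf_succ_zero_le`** (`Tf (lev+1) 0 ≤ M/(n+2)³ + (n+1)·(T lev + 2Ŝ + 2)`);
* **`gain_four`** (`4·2ⁿ·Z ≤ ((2·Nf lev n + 1)·T lev)·G`, from `Xs·(T+1) ≥ 4XL`), `nodes_half_le` (`Nf lev n ≤ 2ⁿ·(2^lev·X/2 + 1)`,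
  `Nh (lev+1) ≤ 2^lev·X + 1`), `zeros_le` (`(2·Nf lev n + 1)·T lev ≤ 2^{n+4}·X·L`);
* `letters_real`, `slab_real`, `log_consts`, the per-derivative directional cost `log_one_add_dir_le`, `Omega_le_Z`.
(The node/`L₀`/`log WC`/`log DΔC` atoms are p1 g11's `ArchG3RecLinesE`/`…FK`, the κ-twins p4 g10's `ArchG3RecLinesCK`.)

## References
* [Nesterenko2003] Yu. V. Nesterenko, LNM 1819 (2003) — §4 (4.3)–(4.5), §4.3 (4.36)–(4.51).
-/

noncomputable section

open Finset Real
open scoped Nat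

namespace Summit.ABC.StewartYu

namespace ArchG3Rec

open PadicG3Par (Cb Cb_pos)
open ArchG3Par (G K yloadK G_eq G_pos K_pos yloadK_pos eight_le_G one_le_K)

variable {n : ℕ} (P : ArchG3Rec n)

/-! ### The order schedule around one half step -/

/-- `T (s+1) ≤ T s / 2 + 1`. [folklore] -/
theorem T_succ_le (s : ℕ) : P.T (s + 1) ≤ P.T s / 2 + 1 := by
  unfold T
  have h1 : 8 * P.L / 2 ^ (s + 1) = 8 * P.L / 2 ^ s / 2 := by rw [pow_succ, Nat.div_div_eq_div_mul]
  rcases le_or_gt (8 * P.L / 2 ^ (s + 1)) 1 with h | h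
  · rw [max_eq_left h]; omega
  · rw [max_eq_right h.le, h1]
    have := Nat.div_le_div_right (c := 2) (le_max_right 1 (8 * P.L / 2 ^ s))
    omega

/-- **`R s ≤ 2·T s + 2·(Ŝ + 1 − s)`** for `s ≤ Ŝ + 1`. [folklore] -/
theorem R_le_two_T (s : ℕ) (hs : s ≤ P.Sd + 1) : P.R s ≤ 2 * P.T s + 2 * (P.Sd + 1 - s) := by
  -- downward induction on `d = Ŝ + 1 − s`
  obtain ⟨d, hd⟩ : ∃ d, s = P.Sd + 1 - d ∧ d ≤ P.Sd + 1 := ⟨P.Sd + 1 - s, by omega, by omega⟩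
  obtain ⟨hsd, hdle⟩ := hd
  subst hsd
  induction d with
  | zero => rw [Nat.sub_zero, P.R_eq_zero (P.Sd + 1) (Nat.lt_succ_self _)]; omega
  | succ d ih =>
    have ih' := ih (by omega)
    have hs : P.Sd + 1 - (d + 1) ≤ P.Sd := by omega
    rw [P.R_eq_add _ hs]
    have e : P.Sd + 1 - (d + 1) + 1 = P.Sd + 1 - d := by omega
    rw [e]
    have hT := P.T_succ_le (P.Sd + 1 - (d + 1))
    rw [e] at hT
    omega

/-- **the order after the half step**: `Tf (lev+1) 0 ≤ M/(n+2)³ + (n+1)·(T lev + 2Ŝ + 2)` (`lev < Ŝ`; in `ℕ`). [cite: Nesterenko2003, (4.5)] -/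
theorem Tf_succ_zero_le (lev : ℕ) (hlev : lev < P.Sd) :
    P.Tf (lev + 1) 0 ≤ P.M / (n + 2) ^ 3 + (n + 1) * (P.T lev + 2 * P.Sd + 2) := by
  unfold Tf Mord
  have hR : P.R (lev + 1) = P.T (lev + 1) + P.R (lev + 2) := P.R_eq_add (lev + 1) (by omega)
  have hR1 := P.R_le_two_T (lev + 1) (by omega)
  have hT := P.T_succ_le lev
  have h1 : P.R (lev + 2) + P.T (lev + 1) ≤ P.T lev + 2 * P.Sd + 2 := by omega
  have h2 : (n + 1) * P.R (lev + 1 + 1) + (n + 1 - 0) * P.T (lev + 1) ≤ (n + 1) * (P.T lev + 2 * P.Sd + 2) := by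
    rw [Nat.sub_zero, ← Nat.mul_add]; exact Nat.mul_le_mul_left _ h1
  omega

/-- real form: `Tf (lev+1) 0 ≤ 16(n+1)L/(n+2)³ + (n+1)·(T lev + 2Ŝ + 2)`. [folklore] -/
theorem Tf_succ_zero_real_le (lev : ℕ) (hlev : lev < P.Sd) :
    (P.Tf (lev + 1) 0 : ℝ) ≤ 16 * ((n : ℝ) + 1) * P.L / ((n : ℝ) + 2) ^ 3 + ((n : ℝ) + 1) * (P.T lev + 2 * P.Sd + 2) := by
  have h := P.Tf_succ_zero_le lev hlev
  have h1 : (P.Tf (lev + 1) 0 : ℝ) ≤ ((P.M / (n + 2) ^ 3 + (n + 1) * (P.T lev + 2 * P.Sd + 2) : ℕ) : ℝ) := by exact_mod_cast h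
  have h2 : ((P.M / (n + 2) ^ 3 : ℕ) : ℝ) ≤ (P.M : ℝ) / ((n : ℝ) + 2) ^ 3 := by
    have := Nat.cast_div_le (m := P.M) (n := (n + 2) ^ 3) (α := ℝ)
    push_cast at this; exact this
  have hM : (P.M : ℝ) = 16 * ((n : ℝ) + 1) * P.L := by unfold M; push_cast; ring
  push_cast at h1
  rw [hM] at h2
  linarith

/-! ### Nodes and the gain of the half step -/

/-- `Nf lev n = 2ⁿ·Xs lev ≤ 2ⁿ·(2^lev·X/2 + 1)` and `Nh (lev+1) = Xs (lev+1) ≤ 2^lev·X + 1` (real). [cite: Nesterenko2003, (4.3)] -/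
theorem nodes_half_le (lev : ℕ) : (P.Nf lev n : ℝ) ≤ 2 ^ n * (2 ^ lev * P.X / 2 + 1) ∧ (P.Nh (lev + 1) : ℝ) ≤ 2 ^ lev * P.X + 1 ∧
    (1 : ℝ) ≤ P.Nf lev n ∧ (1 : ℝ) ≤ P.Nh (lev + 1) := by
  obtain ⟨e, h1⟩ := P.Nf_real lev n
  have h2 := P.Xs_le_dbl lev
  have h3 := P.Xs_le_dbl (lev + 1)
  have h4 : (1 : ℝ) ≤ P.Xs (lev + 1) := by exact_mod_cast (P.Xs_cap_facts (lev + 1)).1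
  refine ⟨by rw [e]; exact mul_le_mul_of_nonneg_left h2 (by positivity), ?_, ?_, by unfold Nh; exact h4⟩
  · unfold Nh; rw [pow_succ] at h3; linarith
  · rw [e]; have : (1 : ℝ) ≤ 2 ^ n := one_le_pow₀ (by norm_num); nlinarith

/-- **the gain of the half step at level `lev`**: `4·2ⁿ·Z ≤ ((2·Nf lev n + 1)·T lev : ℕ)·G` (`Xs·T ≥ Xs·(T+1)/2 ≥ 2XL`).
[cite: Nesterenko2003, (4.25)] -/
theorem gain_four (lev : ℕ) : 4 * 2 ^ n * P.Z ≤ (((2 * P.Nf lev n + 1) * P.T lev : ℕ) : ℝ) * G n := by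
  have h := P.Xs_mul_ge lev
  obtain ⟨e, hXs⟩ := P.Nf_real lev n
  have hT : (1 : ℝ) ≤ P.T lev := by exact_mod_cast (P.T_facts lev).1
  have hG := (G_pos n).le
  have hXs0 : (0 : ℝ) ≤ P.Xs lev := by linarith
  -- `Xs·T ≥ 2XL`
  have h1 : 2 * (P.X : ℝ) * P.L ≤ (P.Xs lev : ℝ) * P.T lev := by nlinarith
  push_cast
  rw [e]
  unfold Z
  have h2n : (0 : ℝ) ≤ 2 ^ n := by positivity
  have h2 : (2 * (2 ^ n * (P.Xs lev : ℝ)) + 1) * P.T lev ≥ 2 ^ n * (2 * ((P.Xs lev : ℝ) * P.T lev)) := by nlinarith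
  nlinarith [mul_le_mul_of_nonneg_left h1 h2n]

/-! ### Letters in real form -/

/-- `M = 16(n+1)L`, `X·L = Z/G`, `G = 8(n+1)`, `0 < L`, `1 ≤ X`, `1 ≤ T lev ≤ 8L`. [folklore] -/
theorem letters_real (lev : ℕ) : (P.M : ℝ) = 16 * ((n : ℝ) + 1) * P.L ∧ (P.X : ℝ) * P.L = P.Z / G n ∧ G n = 8 * (n + 1) ∧
    (0 : ℝ) < P.L ∧ (64 : ℝ) * (n + 1) ≤ P.X ∧ (1 : ℝ) ≤ P.T lev ∧ (P.T lev : ℝ) ≤ 8 * P.L := by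
  obtain ⟨h1, h8, -⟩ := P.T_facts lev
  refine ⟨by unfold M; push_cast; ring, P.Z_floors.2.2.2, G_eq n, P.L_real.2.1, by exact_mod_cast P.X_floors.1, by exact_mod_cast h1,
    by exact_mod_cast h8⟩

/-- the slab letters at the half step: `0 ≤ wl lev ≤ L/2^lev·e^{−(G+2)} ≤ L/2^lev/2^10`, `0 ≤ γb lev`, `γb 0 ≤ (n+1)·L/2`,
`γb (lev+1) ≤ wl lev` . [folklore] -/
theorem slab_real (lev : ℕ) : 0 ≤ P.wl lev ∧ P.wl lev = (P.L : ℝ) * Real.exp (-(G n + 2)) / 2 ^ lev ∧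
    Real.exp (-(G n + 2)) ≤ 1 / 2 ^ 10 ∧ 0 ≤ P.γb lev ∧ P.γb 0 ≤ ((n : ℝ) + 1) * P.L / 2 ∧ P.γb (lev + 1) ≤ P.wl lev := by
  obtain ⟨-, hw0⟩ := P.wl_facts lev
  obtain ⟨h0, hs, -, hpos⟩ := P.γb_facts lev
  have hG := eight_le_G n
  have hL := P.L_real.2.1
  have he : Real.exp (-(G n + 2)) ≤ 1 / 2 ^ 10 := by
    rw [Real.exp_neg, one_div]
    refine inv_anti₀ (by positivity) ?_
    have h10 : (2 : ℝ) ^ 10 ≤ Real.exp 10 := by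
      have := Real.add_one_le_exp (1 : ℝ)
      have h2 : (2 : ℝ) ≤ Real.exp 1 := by linarith
      calc (2 : ℝ) ^ 10 ≤ (Real.exp 1) ^ 10 := pow_le_pow_left₀ (by norm_num) h2 10
        _ = Real.exp 10 := by rw [← Real.exp_nat_mul]; norm_num
    exact h10.trans (Real.exp_le_exp.mpr (by linarith))
  have hwl0 : P.wl 0 ≤ (P.L : ℝ) / 2 := by
    unfold wl; rw [pow_zero, div_one]
    have : Real.exp (-(G n + 2)) ≤ 1 / 2 := he.trans (by norm_num)
    nlinarith
  refine ⟨hw0.le, rfl, he, hpos.le, ?_, by rw [hs]; linarith⟩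
  rw [h0]; have hn : (0 : ℝ) ≤ n := Nat.cast_nonneg n; nlinarith

/-! ### Small logarithms -/

/-- `log 2 ≤ 7/10`, `log 3 ≤ 7/5`, `log 4 ≤ 7/5`, `log (20·e) ≤ 21/5`. [folklore] -/
theorem log_consts : Real.log 2 ≤ 7 / 10 ∧ Real.log 3 ≤ 7 / 5 ∧ Real.log 4 ≤ 7 / 5 ∧ Real.log (20 * Real.exp 1) ≤ 21 / 5 := by
  have h2 : Real.log 2 ≤ 7 / 10 := by have := Real.log_two_lt_d9; linarith
  have h4 : Real.log 4 ≤ 7 / 5 := by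
    rw [show (4 : ℝ) = 2 ^ 2 by norm_num, Real.log_pow]; push_cast; linarith
  have h3 : Real.log 3 ≤ 7 / 5 := (Real.log_le_log (by norm_num) (by norm_num : (3 : ℝ) ≤ 4)).trans h4
  refine ⟨h2, h3, h4, ?_⟩
  have he : Real.exp 1 ≤ 3 := by have := Real.exp_one_lt_d9; linarith
  have h64 : 20 * Real.exp 1 ≤ 2 ^ 6 := by linarith
  calc Real.log (20 * Real.exp 1) ≤ Real.log (2 ^ 6) := Real.log_le_log (by positivity) h64
    _ = 6 * Real.log 2 := by rw [Real.log_pow]; push_cast; ring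
    _ ≤ 21 / 5 := by linarith

/-- **the per-derivative directional cost**: if `0 ≤ Y ≤ y·B·N²·L` with `1 ≤ y`, `1 ≤ B`, and `8(n+1)L ≤ (n+2)³·T′`, `1 ≤ T′`, then
`log (1 + Y/T′) ≤ 1 + log y + log B + 2·log N + 3·log(n+2)`. [cite: Nesterenko2003, §4.2 (4.20)–(4.23); shape only] -/
theorem log_one_add_dir_le {Y y T' : ℝ} (hY0 : 0 ≤ Y) (hY : Y ≤ y * P.Bexp * P.N ^ 2 * P.L) (hy : 1 ≤ y)
    (hT : 8 * ((n : ℝ) + 1) * P.L ≤ ((n : ℝ) + 2) ^ 3 * T') (hT1 : 1 ≤ T') :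
    Real.log (1 + Y / T') ≤ 1 + Real.log y + (P.W - 1) + 2 * Real.log P.N + 3 * Real.log ((n : ℝ) + 2) := by
  have hN := P.N_facts
  have hL := P.L_real.2.1
  have hB : 1 ≤ P.Bexp := by unfold Bexp; exact Real.one_le_exp (by linarith [P.hW])
  have hT0 : 0 < T' := by linarith
  -- `Y/T' ≤ y B N² (n+2)³/(8(n+1)) ≤ y B N² (n+2)³`
  have h1 : Y / T' ≤ y * P.Bexp * P.N ^ 2 * ((n : ℝ) + 2) ^ 3 := by
    rw [div_le_iff₀ hT0]
    have h2 : y * P.Bexp * P.N ^ 2 * P.L ≤ y * P.Bexp * P.N ^ 2 * (((n : ℝ) + 2) ^ 3 * T') := by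
      refine mul_le_mul_of_nonneg_left ?_ (by positivity)
      have hn : (0 : ℝ) ≤ n := Nat.cast_nonneg n
      nlinarith
    nlinarith
  have hq : 1 ≤ y * P.Bexp * P.N ^ 2 * ((n : ℝ) + 2) ^ 3 := by
    have h3 : (1 : ℝ) ≤ P.N ^ 2 := one_le_pow₀ hN.2.1
    have h4 : (1 : ℝ) ≤ ((n : ℝ) + 2) ^ 3 := one_le_pow₀ (by linarith [Nat.cast_nonneg (α := ℝ) n])
    exact one_le_mul_of_one_le_of_one_le (one_le_mul_of_one_le_of_one_le (one_le_mul_of_one_le_of_one_le hy hB) h3) h4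
  have h5 : Real.log (1 + Y / T') ≤ Real.log (2 * (y * P.Bexp * P.N ^ 2 * ((n : ℝ) + 2) ^ 3)) :=
    Real.log_le_log (by positivity) (by linarith)
  have hn2 : (0 : ℝ) < (n : ℝ) + 2 := by positivity
  have hy0 : 0 < y := by linarith
  have hB0 : 0 < P.Bexp := by linarith
  have e5 : Real.log (2 * (y * P.Bexp * P.N ^ 2 * ((n : ℝ) + 2) ^ 3)) =
      Real.log 2 + Real.log y + Real.log P.Bexp + 2 * Real.log P.N + 3 * Real.log ((n : ℝ) + 2) := by
    have hA : 0 < y * P.Bexp := mul_pos hy0 hB0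
    have hB : 0 < y * P.Bexp * P.N ^ 2 := mul_pos hA (pow_pos hN.1 2)
    have hC : 0 < y * P.Bexp * P.N ^ 2 * ((n : ℝ) + 2) ^ 3 := mul_pos hB (pow_pos hn2 3)
    rw [Real.log_mul two_ne_zero hC.ne', Real.log_mul hB.ne' (pow_pos hn2 3).ne', Real.log_mul hA.ne' (pow_pos hN.1 2).ne',
      Real.log_mul hy0.ne' hB0.ne', Real.log_pow, Real.log_pow]
    push_cast; ring
  have hBl : Real.log P.Bexp = P.W - 1 := by unfold Bexp; rw [Real.log_exp]
  rw [e5, hBl] at h5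
  linarith [log_consts.1]

/-! ### The weights against `Z`, the zero count of a half step -/

/-- **the weights are tiny against `Z`**: `Ω ≤ Z/2^17`, `Σ A ≤ n·Ω`, `AθsumR ≤ n²·Ω`. [folklore] -/
theorem Omega_le_Z : P.Ω ≤ P.Z / 2 ^ 17 ∧ P.SAR ≤ n * P.Ω ∧ P.AθsumR ≤ (n : ℝ) ^ 2 * P.Ω ∧ 0 ≤ P.Ω := by
  have h1 := P.Omega_le_L_WN
  obtain ⟨hZ, hZW, -, -⟩ := P.Z_floors
  obtain ⟨hS, hA, hS0⟩ := P.SAR_le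
  have hΩ := P.Ω_facts.1
  have hK := one_le_K n
  have hCb : (64 : ℝ) ≤ Cb := by unfold Cb PadicG3Par.cM; have := Real.exp_one_gt_d9; push_cast; nlinarith
  have hCbn : (64 : ℝ) ≤ Cb ^ n := by
    have hn := P.hn
    calc (64 : ℝ) ≤ 64 ^ n := by exact_mod_cast Nat.le_self_pow (by omega) 64
      _ ≤ Cb ^ n := pow_le_pow_left₀ (by norm_num) hCb n
  have hK1 : (1 : ℝ) ≤ K n := by exact_mod_cast hK
  have hn1 : (1 : ℝ) ≤ (n : ℝ) + 1 := by linarith [Nat.cast_nonneg (α := ℝ) n]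
  refine ⟨?_, hS, by nlinarith [Nat.cast_nonneg (α := ℝ) n], hΩ.le⟩
  -- `48·64·Ω ≤ 48 Cbⁿ K Ω ≤ L·WN ≤ Z/64`, `48·64·64 ≥ 2^17`
  have h2 : 48 * 64 * P.Ω ≤ P.L * P.WN := by nlinarith [mul_le_mul hCbn hK1 zero_le_one (by positivity)]
  have h3 : 64 * P.L * P.WN ≤ P.Z := by nlinarith [P.L_real.2.1, P.WN_bounds.2.2.2]
  rw [le_div_iff₀ (by positivity)]
  nlinarith

/-- **the zero count of a half step is at most `2^{n+4}·X·L`**: `(2·Nf lev n + 1)·T lev ≤ 2^{n+4}·X·L` (both caps of `Xs`).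
[cite: Nesterenko2003, (4.3); shape only] -/
theorem zeros_le (lev : ℕ) : (((2 * P.Nf lev n + 1) * P.T lev : ℕ) : ℝ) ≤ 2 ^ (n + 4) * ((P.X : ℝ) * P.L) := by
  obtain ⟨e, hXs⟩ := P.Nf_real lev n
  obtain ⟨-, hcap⟩ := P.Xs_cap_facts lev
  obtain ⟨hT1, hT8, -⟩ := P.T_facts lev
  have hX : (128 : ℝ) ≤ P.X := P.X_floors.2.1
  have hL := P.L_real
  -- `Xs·(T+1) ≤ 4XL + T + 1`
  have h1 : (P.Xs lev : ℝ) * (P.T lev + 1) ≤ 4 * P.X * P.L + (P.T lev + 1) := by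
    have h2 : P.Xs lev * (P.T lev + 1) ≤ 4 * P.X * P.L + (P.T lev + 1) := by
      have hq := Nat.div_mul_le_self (4 * P.X * P.L) (P.T lev + 1)
      calc P.Xs lev * (P.T lev + 1) ≤ (4 * P.X * P.L / (P.T lev + 1) + 1) * (P.T lev + 1) := Nat.mul_le_mul_right _ hcap
        _ = 4 * P.X * P.L / (P.T lev + 1) * (P.T lev + 1) + (P.T lev + 1) := by ring
        _ ≤ 4 * P.X * P.L + (P.T lev + 1) := Nat.add_le_add_right hq _
    exact_mod_cast h2
  have hT8' : (P.T lev : ℝ) ≤ 8 * P.L := by exact_mod_cast hT8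
  have hT1' : (1 : ℝ) ≤ P.T lev := by exact_mod_cast hT1
  push_cast
  rw [e]
  have h2n : (1 : ℝ) ≤ 2 ^ n := one_le_pow₀ (by norm_num)
  have hpow : (2 : ℝ) ^ (n + 4) = 2 ^ n * 16 := by rw [pow_add]; norm_num
  rw [hpow]
  -- `(2·2ⁿXs + 1)·T ≤ 2ⁿ·2·Xs·(T+1) + T ≤ 2ⁿ(8XL + 2T + 2) + T ≤ 2ⁿ·16·XL`
  have hXs0 : (0 : ℝ) ≤ P.Xs lev := by linarith
  have hA : (2 * (2 ^ n * (P.Xs lev : ℝ)) + 1) * P.T lev ≤ 2 ^ n * (2 * ((P.Xs lev : ℝ) * (P.T lev + 1))) + P.T lev := by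
    nlinarith [mul_nonneg (by positivity : (0:ℝ) ≤ 2 ^ n) hXs0]
  have hB : 2 ^ n * (2 * ((P.Xs lev : ℝ) * (P.T lev + 1))) ≤ 2 ^ n * (8 * P.X * P.L + 2 * P.T lev + 2) :=
    mul_le_mul_of_nonneg_left (by linarith) (by positivity)
  have hC : 2 ^ n * (8 * (P.X : ℝ) * P.L + 2 * P.T lev + 2) + P.T lev ≤ 2 ^ n * 16 * ((P.X : ℝ) * P.L) := by
    have h5 : 2 * (P.T lev : ℝ) + 2 + P.T lev ≤ 8 * ((P.X : ℝ) * P.L) := by nlinarith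
    have h6 : (P.T lev : ℝ) ≤ 2 ^ n * P.T lev := le_mul_of_one_le_left (by linarith) (by linarith)
    nlinarith [mul_le_mul_of_nonneg_left h5 (by positivity : (0:ℝ) ≤ 2 ^ n)]
  linarith

end ArchG3Rec

end Summit.ABC.StewartYu

end
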